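import Summits.QuantumFields.BalabanUV.T4Continuum.Support.NE9FutureProfileStep

/-!
# NE9FutureProfileStepOffCentre — ROUTE R4♯-T «TRANSLATION-AWARE SP CHAIN», PIECE (T-b): the step of route R4 in future-influence
# coordinates has OFF-CENTRE images as soon as the new-slice map has a table-free part
# (cell `pub-balaban`, T4-DAG §6 NE9, route R4 of `t4/ROUTES-NE9.md` v9.0.1 (rank 1); refuter PRICING-NE9 v10 §E (F-v10-4 ∕ Q-v10-1);
# INTERFACE REQUEST NE9 worded by the BINDER row NE9 OWNER `b2b-balaban-t4-ne9-p1` gen 61, CLAIMS.log l.29955 ∕ HOME/INBOX «(T-b) →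
# leaf-04»; planner `t4-ne9-idea-1` gen 9's HOME scratch `t4/ideate/NE9/lens1-NE9OffCentreChain.lean` §7, offer O-v9-T; unit
# `b2b-balaban-t4-ne9-formalise-leaf-04` gen 50; imports the tree's K2♭ PART 1 `NE9FutureProfileStep` ONLY; modifies nothing)

HONEST FRAMING (T4-DAG PAGE 1).  Rung (B)+1 of the FINITE-VOLUME T⁴ programme — NOT infinite volume, NOT a mass gap, NOT the
Clay problem.  NE9 (`T4OutputRate.NE9` ∧ `FadingMemory`) is a cell NEW ESTIMATE, NOT PRINTED in [I] = [Balaban1987RG1] (CMP 109),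
[II] = [Balaban1988RG2Cluster] (CMP 116), and NOT PROVED for Bałaban's E^{(j)} («NE9 ⇐ the named binders»; spine PROVED 0∕9; row NE9
WALLED ON A MODEL, O-NE9-1).  HONEST DEPENDENCY (cell line, verbatim): continuum YM on T⁴ ⇐ BetaPertH ∧ nine spine estimates (0/9
proved); BetaPertH ⇐ (D1) ∧ (D4) ∧ CAP+tail; G-an2-4 gates asym, D1 and NE2/3/4.  `FlowStep.BetaPertH`, (B), (B^μ) do not occur.
This file is GENERIC complex-Banach bookkeeping on the tree's `NE9FutureProfileStep.step`: it constructs NO object of Bałaban's and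
discharges NO Bałaban-side hypothesis; nothing printed is asserted (ABSOLUTE RULE); no `def` at all, no `def … : Prop`; 0 sorry.  A
sharper RATE inside a CONDITIONAL END is not progress on the estimate itself (refuter: rate-only ∕ cell-neutral; no life region, no
instance letter, no wall moves).

WHAT THIS FILE DOES.  K2♭ (`NE9FutureProfileStep.mapsTo_step` ∕ `holoSelfMaps_step`) spends the WHOLE size `B₀` of the new-slice map
`Φ k (g k)` on the RADIUS: `step W Φ J τ₀ ωh k g` maps the `r`-ball of 𝔛 = 𝔜 × Fut W Pot into the CENTRED ball of radius `ωh·r + τ₀·B₀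
≤ θ·r`.  If instead `Φ k (g k)` maps the table ball into an OFF-CENTRE ball `closedBall cY B₁` — a table-free part `cY` plus a
table-dependent part of size `B₁` (on the record: `cY` = the `explZ` part of the vacuum-subtracted slice, table-free BY TYPE, `B₁ = 2B`;
PRICING-NE9 v10 (E10-1); the record clause (T-c) is the OWNER lineage's) — then the step's image lies in the OFF-CENTRE ball of 𝔛 with
centre `((τ₀ : ℂ) • cY, J k cY)` (slice block `τ₀ • cY`, profile block `J k cY` — `J k` is ℂ-linear and history-free by type) and
radius `r₄ ≥ ωh·r + τ₀·B₁`, the centre having norm `≤ τ₀·‖cY‖` (`‖J k‖ ≤ τ₀`): the table-free part is spent on the CENTRE, not on the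
RADIUS (§3, §4).  The finer BLOCK form (§2) records the two radii separately: `τ₀·B₁` for the slice block, `ωh·r + τ₀·B₁` for the
profile block.  §4 `holoMaps_step_offCentre` is the OWNER-worded interface (a family of centres `cY k g`, `‖cY k g‖ ≤ cbar₀` on the
window; history-free centres `fun k _ => c₀ k` are the record's case), with the three suppliers `differentiableOn_step` ∕
`mapsTo_step_offCentre_family` ∕ `norm_centre_le_of_le` = the binders `hSd` ∕ `hSm` ∕ `hc` of leaf-03 g44's (T-a) cut
`NE9PolydiscChainOffCentre.chainLipschitz_of_holoMaps_offCentre` (CLAIMS.log l.29988; `c k g := (τ₀ • cY k g, J k (cY k g))`,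
`cbar := τ₀·cbar₀`); §5
`offCentreMaps_step` is idea-1's ∃-form — the hypothesis `hS` of its §5 `chainLipschitz_of_offCentreMaps_polydisc` (= piece (T-a),
`NE9PolydiscChainOffCentre`, NOT imported here: it is leaf-03's ∕ idea-1's and does not exist in the tree at this filing; the one-line
composition «(T-a) ∘ (T-b) ⇒ `ChainLipschitz (step …) W r θ (1∕(1−θ²)) λ`» rides with whichever of (T-a) ∕ the owner's END re-thread
lands second); §6 records CONSISTENCY with K2♭: the same off-centre binders with the total room `τ₀·cbar₀ + r₄ ≤ θ·r` give the centred
`hΦb` and `HoloSelfMaps (step …) W r θ` BY NAME, so every END of record at rate θ (E132 ∕ K2♭-SP ∕ record-SP) stays available from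
them — downstream the translation only improves the per-step factor θ ↦ λ*(c̄, r₄) ≤ θ (refuter §E; idea-1's kernel 409b85d4eb69d683).
§1 isolates the holomorphy half of K2♭ §4 (no size hypothesis); §0 is the two-line normed-group glue used by (T-c)-type dockings; §7 a
toy with a genuinely history-free centre (every binder of §4∕§6 inhabited, θ = 19∕32 < 1).

References (TYPES ∕ loci only): [EH1970] C. J. Earle, R. S. Hamilton, Proc. Symp. Pure Math. XVI (1970) 61–65; [Balaban1988RG2Cluster]
T. Bałaban, CMP **116** (1988) 1–22, (2.38)–(2.41) pp. 20–21 (the table-free `½E₀` part, p. 21 l. 23–31); [Balaban1987RG1] T. Bałaban,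
CMP **109** (1987), (2.13) p. 268.  Summits-side NEW work (LEAN PLACEMENT RULE).
-/

namespace Summit.QuantumFields.BalabanUV.T4Continuum.NE9FutureProfileStepOffCentre

open Metric Set
open Literature.MathematicalPhysics.QuantumFieldTheory.Balaban1983to89.T4OutputRate (Window mem_window)
open Summit.QuantumFields.BalabanUV.T4Continuum.NE9EarleHamiltonChain (HoloSelfMaps)
open Summit.QuantumFields.BalabanUV.T4Continuum.NE9FutureProfileStep
  (Idx Fut shift step step_of_mem apply_snd_mem_ball norm_shift_apply_le holoSelfMaps_step)

/-! ## §0 Normed-group glue: an off-centre image from a «centre + bounded part» splitting, and back to a centred bound -/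

section glue

variable {P Y : Type*} [SeminormedAddCommGroup Y]

/-- If `ψ = c + (table part)` pointwise and the table part maps `s` into the centred `B₁`-ball, then `ψ` maps `s` into the
OFF-CENTRE ball `closedBall c B₁` (the shape in which a (T-c)-type record clause is fed to §3∕§4). [folklore] -/
theorem mapsTo_closedBall_of_eq_add {s : Set P} {ψ φ : P → Y} {c : Y} {B₁ : ℝ}
    (hφ : MapsTo φ s (closedBall 0 B₁)) (hψ : ∀ p ∈ s, ψ p = c + φ p) :
    MapsTo ψ s (closedBall c B₁) := by
  intro p hp
  have h := hφ hp
  rw [mem_closedBall_zero_iff] at h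
  rw [mem_closedBall, dist_eq_norm, hψ p hp, add_sub_cancel_left]
  exact h

/-- An off-centre image is a centred image of radius `‖c‖ + B₁` (monotonicity; the way K2♭'s centred `hΦb` is recovered from
the off-centre binder, with `B₀ := cbar₀ + B₁`). [folklore] -/
theorem mapsTo_closedBall_zero_of_offCentre {s : Set P} {ψ : P → Y} {c : Y} {B₁ cbar₀ : ℝ}
    (hψ : MapsTo ψ s (closedBall c B₁)) (hc : ‖c‖ ≤ cbar₀) :
    MapsTo ψ s (closedBall 0 (cbar₀ + B₁)) := by
  intro p hp
  have h := hψ hp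
  rw [mem_closedBall, dist_eq_norm] at h
  rw [mem_closedBall_zero_iff]
  calc ‖ψ p‖ = ‖c + (ψ p - c)‖ := by rw [add_sub_cancel]
    _ ≤ ‖c‖ + ‖ψ p - c‖ := norm_add_le _ _
    _ ≤ cbar₀ + B₁ := add_le_add hc h

end glue

/-! ## §1 Holomorphy of the step from FRÉCHET holomorphy of the new-slice map alone (K2♭ §4 without the size half) -/

variable {𝔜 Pot : Type*} [NormedAddCommGroup 𝔜] [NormedSpace ℂ 𝔜] [NormedAddCommGroup Pot] [NormedSpace ℂ Pot]
variable {W : Set (ℕ → ℝ)} {Φ : ℕ → ℝ → Pot → 𝔜} {J : ℕ → (𝔜 →L[ℂ] Fut W Pot)} {τ₀ ωh : ℝ}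

/-- **HOLOMORPHY OF THE STEP.**  `step W Φ J τ₀ ωh k g = (bounded affine) ∘ Φ k (g k) ∘ ev_{(0,g)}` is Fréchet-holomorphic on the
`r`-ball of 𝔛 as soon as `Φ k (g k)` is Fréchet-holomorphic on the `r`-ball of `Pot` — no size, room or centre hypothesis (this is the
first half of K2♭'s `holoSelfMaps_step`, isolated so that off-centre size data can be paired with it). [folklore] -/
theorem differentiableOn_step {r : ℝ} (hΦd : ∀ k, ∀ g ∈ W, DifferentiableOn ℂ (Φ k (g k)) (ball (0 : Pot) r))
    (k : ℕ) {g : ℕ → ℝ} (hg : g ∈ W) :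
    DifferentiableOn ℂ (step W Φ J τ₀ ωh k g) (ball (0 : 𝔜 × Fut W Pot) r) := by
  -- the evaluation at the index (0, g) composed with the second projection is a bounded linear map
  have hev : DifferentiableOn ℂ (fun z : 𝔜 × Fut W Pot => z.2 ⟨0, ⟨g, hg⟩⟩) (ball 0 r) :=
    (((BoundedContinuousFunction.evalCLM ℂ (⟨0, ⟨g, hg⟩⟩ : Idx W)).comp
      (ContinuousLinearMap.snd ℂ 𝔜 (Fut W Pot))).differentiable.differentiableOn).congr fun _ _ => rfl
  have hΦc : DifferentiableOn ℂ (fun z : 𝔜 × Fut W Pot => Φ k (g k) (z.2 ⟨0, ⟨g, hg⟩⟩)) (ball 0 r) :=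
    (hΦd k g hg).comp hev fun z hz => apply_snd_mem_ball hz _
  have h1 : DifferentiableOn ℂ (fun z : 𝔜 × Fut W Pot => (τ₀ : ℂ) • Φ k (g k) (z.2 ⟨0, ⟨g, hg⟩⟩)) (ball 0 r) :=
    hΦc.const_smul (τ₀ : ℂ)
  have h2 : DifferentiableOn ℂ
      (fun z : 𝔜 × Fut W Pot => (ωh : ℂ) • shift W z.2 + J k (Φ k (g k) (z.2 ⟨0, ⟨g, hg⟩⟩))) (ball 0 r) :=
    (((shift W).differentiable.comp differentiable_snd).differentiableOn.const_smul (ωh : ℂ)).add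
      ((J k).differentiable.comp_differentiableOn hΦc)
  exact (h1.prodMk h2).congr fun z _ => step_of_mem hg z

/-! ## §2 BLOCK FORM: the slice block and the profile block of the step, each in its own off-centre ball -/

/-- **THE STEP MINUS ITS CENTRE**, on the window: for ANY `cY : 𝔜`,
`step … z − (τ₀ • cY, J k cY) = (τ₀ • (P − cY), ωh • shift z.2 + J k (P − cY))`, `P = Φ k (g k) (z.2 (0, g))` — the `J k`-part
RECENTRES by linearity. [folklore] -/
theorem step_sub_centre (k : ℕ) {g : ℕ → ℝ} (hg : g ∈ W) (cY : 𝔜) (z : 𝔜 × Fut W Pot) :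
    step W Φ J τ₀ ωh k g z - ((τ₀ : ℂ) • cY, J k cY) =
      ((τ₀ : ℂ) • (Φ k (g k) (z.2 ⟨0, ⟨g, hg⟩⟩) - cY),
        (ωh : ℂ) • shift W z.2 + J k (Φ k (g k) (z.2 ⟨0, ⟨g, hg⟩⟩) - cY)) := by
  rw [step_of_mem hg, Prod.mk_sub_mk, smul_sub, map_sub]
  congr 1
  abel

/-- **BLOCK FORM OF THE OFF-CENTRE IMAGE.**  If `Φ k (g k)` maps the table ball `ball 0 r` into `closedBall cY B₁` and `‖J k‖ ≤ τ₀`,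
then for `z` in the `r`-ball of 𝔛 the SLICE block of `step … z` lies in `closedBall (τ₀ • cY) (τ₀·B₁)` and the PROFILE block in
`closedBall (J k cY) (ωh·r + τ₀·B₁)` (the shift part `ωh • shift z.2` has norm `≤ ωh·r`; the injected part recentres by linearity).
No room hypothesis. [folklore] -/
theorem step_mem_closedBall_prod {r B₁ : ℝ} (hτ₀ : 0 ≤ τ₀) (hωh : 0 ≤ ωh) (hJ : ∀ k, ‖J k‖ ≤ τ₀)
    (k : ℕ) {g : ℕ → ℝ} (hg : g ∈ W) {cY : 𝔜} (hm : MapsTo (Φ k (g k)) (ball (0 : Pot) r) (closedBall cY B₁))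
    {z : 𝔜 × Fut W Pot} (hz : z ∈ ball (0 : 𝔜 × Fut W Pot) r) :
    step W Φ J τ₀ ωh k g z ∈ closedBall ((τ₀ : ℂ) • cY) (τ₀ * B₁) ×ˢ closedBall (J k cY) (ωh * r + τ₀ * B₁) := by
  have hzr : ‖z‖ < r := mem_ball_zero_iff.mp hz
  have hP : ‖Φ k (g k) (z.2 ⟨0, ⟨g, hg⟩⟩) - cY‖ ≤ B₁ := by
    have h := hm (apply_snd_mem_ball hz ⟨0, ⟨g, hg⟩⟩)
    rwa [mem_closedBall, dist_eq_norm] at h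
  rw [step_of_mem hg]
  refine Set.mk_mem_prod ?_ ?_
  · rw [mem_closedBall, dist_eq_norm, ← smul_sub, norm_smul, Complex.norm_real, Real.norm_of_nonneg hτ₀]
    exact mul_le_mul_of_nonneg_left hP hτ₀
  · rw [mem_closedBall, dist_eq_norm]
    have h3 : (ωh : ℂ) • shift W z.2 + J k (Φ k (g k) (z.2 ⟨0, ⟨g, hg⟩⟩)) - J k cY =
        (ωh : ℂ) • shift W z.2 + J k (Φ k (g k) (z.2 ⟨0, ⟨g, hg⟩⟩) - cY) := by
      rw [map_sub]; abel
    rw [h3]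
    refine (norm_add_le _ _).trans (add_le_add ?_ ?_)
    · rw [norm_smul, Complex.norm_real, Real.norm_of_nonneg hωh]
      exact mul_le_mul_of_nonneg_left (((norm_shift_apply_le W z.2).trans (norm_snd_le z)).trans hzr.le) hωh
    · exact ((J k).le_of_opNorm_le (hJ k) _).trans (mul_le_mul_of_nonneg_left hP hτ₀)

/-! ## §3 SUP-NORM FORM: the step maps the `r`-ball into ONE off-centre ball of 𝔛, centre `(τ₀ • cY, J k cY)`, radius `r₄` -/

/-- **THE CENTRE'S SIZE**: `‖(τ₀ • cY, J k cY)‖ ≤ τ₀·‖cY‖` as soon as `‖J k‖ ≤ τ₀` (sup norm of the pair; on the record this is the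
refuter's `c̄ = τ̄·p̄₀`). [folklore] -/
theorem norm_centre_le (hτ₀ : 0 ≤ τ₀) (hJ : ∀ k, ‖J k‖ ≤ τ₀) (k : ℕ) (cY : 𝔜) :
    ‖(((τ₀ : ℂ) • cY, J k cY) : 𝔜 × Fut W Pot)‖ ≤ τ₀ * ‖cY‖ := by
  rw [Prod.norm_mk]
  refine max_le ?_ ((J k).le_of_opNorm_le (hJ k) cY)
  rw [norm_smul, Complex.norm_real, Real.norm_of_nonneg hτ₀]

/-- **OFF-CENTRE IMAGE OF THE STEP (sup-norm form).**  `Φ k (g k) : ball 0 r → closedBall cY B₁`, `‖J k‖ ≤ τ₀` and the room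
`ωh·r + τ₀·B₁ ≤ r₄` give `MapsTo (step …) (ball 0 r) (closedBall (τ₀ • cY, J k cY) r₄)` (on the record `r₄ = ω̂R₀ + 2Bτ̄`).  Compare
K2♭'s `mapsTo_step`: centre `0`, room `ωh·r + τ₀·B₀ ≤ θ·r` with `B₀ = ‖cY‖ + B₁`. [folklore] -/
theorem mapsTo_step_offCentre {r B₁ r₄ : ℝ} (hτ₀ : 0 ≤ τ₀) (hωh : 0 ≤ ωh) (hJ : ∀ k, ‖J k‖ ≤ τ₀)
    (hroom : ωh * r + τ₀ * B₁ ≤ r₄) (k : ℕ) {g : ℕ → ℝ} (hg : g ∈ W) {cY : 𝔜}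
    (hm : MapsTo (Φ k (g k)) (ball (0 : Pot) r) (closedBall cY B₁)) :
    MapsTo (step W Φ J τ₀ ωh k g) (ball (0 : 𝔜 × Fut W Pot) r) (closedBall ((τ₀ : ℂ) • cY, J k cY) r₄) := by
  intro z hz
  have hzr : ‖z‖ < r := mem_ball_zero_iff.mp hz
  have hωr : 0 ≤ ωh * r := mul_nonneg hωh ((norm_nonneg z).trans hzr.le)
  have hblk := step_mem_closedBall_prod hτ₀ hωh hJ k hg hm hz
  rw [Set.mem_prod, mem_closedBall, mem_closedBall, dist_eq_norm, dist_eq_norm] at hblk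
  rw [mem_closedBall, dist_eq_norm, Prod.norm_def, Prod.fst_sub, Prod.snd_sub]
  exact max_le (hblk.1.trans ((le_add_of_nonneg_left hωr).trans hroom)) (hblk.2.trans hroom)

/-! ## §4 THE OWNER-WORDED INTERFACE (T-b): a family of centres `cY k g`, both halves of the off-centre self-map datum -/

/-- **(T-b) `holoMaps_step_offCentre` — K2♭'s `holoSelfMaps_step` OFF-CENTRE TWIN.**  From Fréchet holomorphy of `Φ k (g k)` on the
table ball, an off-centre Φ-size `MapsTo (Φ k (g k)) (ball 0 r) (closedBall (cY k g) B₁)` for a FAMILY of centres `cY : ℕ → (ℕ → ℝ) →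
𝔜` (one centre per step and history; HISTORY-FREE centres — the record's case, the `explZ` part being coupling-free and table-free by
type — are the special case `fun k _ => c₀ k`; within ONE chain the history `g` is fixed, so a chain estimate comparing two initial
tables under the SAME maps sees `cY k g` as a constant), `‖J k‖ ≤ τ₀`, and the room `ωh·r + τ₀·B₁ ≤ r₄`: for every `k` and `g ∈ W` the
step `step W Φ J τ₀ ωh k g` is holomorphic on `ball 0 r` and maps it into the off-centre ball of 𝔛 with centre
`(τ₀ • cY k g, J k (cY k g))` — slice-block centre `τ₀ • cY k g`, profile-block centre `J k (cY k g)` (`J k` ℂ-linear, `g`-free) — and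
the ONE radius `r₄`; the centres have norm `≤ τ₀·cbar₀` by `norm_centre_le_of_le`.  The three suppliers `differentiableOn_step` (§1),
`mapsTo_step_offCentre_family`, `norm_centre_le_of_le` are, binder for binder, the hypotheses `hSd` ∕ `hSm` ∕ `hc` of a
translation-aware polydisc chain ((T-a), `c k g := (τ₀ • cY k g, J k (cY k g))`, `cbar := τ₀·cbar₀`); no quadratic test, no `θ`, no
polydisc structure occurs here. [folklore] -/
theorem holoMaps_step_offCentre {r B₁ r₄ : ℝ} (hτ₀ : 0 ≤ τ₀) (hωh : 0 ≤ ωh)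
    (hΦd : ∀ k, ∀ g ∈ W, DifferentiableOn ℂ (Φ k (g k)) (ball (0 : Pot) r)) (cY : ℕ → (ℕ → ℝ) → 𝔜)
    (hΦoff : ∀ k, ∀ g ∈ W, MapsTo (Φ k (g k)) (ball (0 : Pot) r) (closedBall (cY k g) B₁))
    (hJ : ∀ k, ‖J k‖ ≤ τ₀) (hroom : ωh * r + τ₀ * B₁ ≤ r₄) :
    ∀ k, ∀ g ∈ W, DifferentiableOn ℂ (step W Φ J τ₀ ωh k g) (ball (0 : 𝔜 × Fut W Pot) r) ∧
      MapsTo (step W Φ J τ₀ ωh k g) (ball (0 : 𝔜 × Fut W Pot) r)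
        (closedBall ((τ₀ : ℂ) • cY k g, J k (cY k g)) r₄) :=
  fun k g hg => ⟨differentiableOn_step hΦd k hg, mapsTo_step_offCentre hτ₀ hωh hJ hroom k hg (hΦoff k g hg)⟩

/-- **The `hSm` supplier**: the size half of §4 alone (no holomorphy hypothesis). [folklore] -/
theorem mapsTo_step_offCentre_family {r B₁ r₄ : ℝ} (hτ₀ : 0 ≤ τ₀) (hωh : 0 ≤ ωh) (hJ : ∀ k, ‖J k‖ ≤ τ₀)
    (cY : ℕ → (ℕ → ℝ) → 𝔜) (hΦoff : ∀ k, ∀ g ∈ W, MapsTo (Φ k (g k)) (ball (0 : Pot) r) (closedBall (cY k g) B₁))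
    (hroom : ωh * r + τ₀ * B₁ ≤ r₄) :
    ∀ k, ∀ g ∈ W, MapsTo (step W Φ J τ₀ ωh k g) (ball (0 : 𝔜 × Fut W Pot) r)
      (closedBall ((τ₀ : ℂ) • cY k g, J k (cY k g)) r₄) :=
  fun k g hg => mapsTo_step_offCentre hτ₀ hωh hJ hroom k hg (hΦoff k g hg)

/-- **The `hc` supplier**: the centres of §4 are uniformly small — `‖cY k g‖ ≤ cbar₀` on the window gives
`‖(τ₀ • cY k g, J k (cY k g))‖ ≤ τ₀·cbar₀` on the window (the chain's `cbar`; on the record `τ̄·p̄₀`). [folklore] -/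
theorem norm_centre_le_of_le {cbar₀ : ℝ} (hτ₀ : 0 ≤ τ₀) (hJ : ∀ k, ‖J k‖ ≤ τ₀) (cY : ℕ → (ℕ → ℝ) → 𝔜)
    (hcY : ∀ k, ∀ g ∈ W, ‖cY k g‖ ≤ cbar₀) :
    ∀ k, ∀ g ∈ W, ‖(((τ₀ : ℂ) • cY k g, J k (cY k g)) : 𝔜 × Fut W Pot)‖ ≤ τ₀ * cbar₀ :=
  fun k g hg => (norm_centre_le hτ₀ hJ k (cY k g)).trans (mul_le_mul_of_nonneg_left (hcY k g hg) hτ₀)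

/-- **HISTORY-FREE CENTRES** (the record's case, OWNER g62 (W3): `cY k` = the `explZ`-part of the vacuum-subtracted slice, `B₁ = 2B`,
`cbar₀ = p̄₀`): §4 at the constant family `fun k _ => cY k` — both halves, centre `(τ₀ • cY k, J k (cY k))`, ONE radius `r₄`.
Feeds a function-face chain ((T-a)) at `c := fun k _ => (τ₀ • cY k, J k (cY k))`. [folklore] -/
theorem holoMaps_step_offCentre_free {r B₁ r₄ : ℝ} (hτ₀ : 0 ≤ τ₀) (hωh : 0 ≤ ωh)
    (hΦd : ∀ k, ∀ g ∈ W, DifferentiableOn ℂ (Φ k (g k)) (ball (0 : Pot) r)) (cY : ℕ → 𝔜)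
    (hΦoff : ∀ k, ∀ g ∈ W, MapsTo (Φ k (g k)) (ball (0 : Pot) r) (closedBall (cY k) B₁))
    (hJ : ∀ k, ‖J k‖ ≤ τ₀) (hroom : ωh * r + τ₀ * B₁ ≤ r₄) :
    ∀ k, ∀ g ∈ W, DifferentiableOn ℂ (step W Φ J τ₀ ωh k g) (ball (0 : 𝔜 × Fut W Pot) r) ∧
      MapsTo (step W Φ J τ₀ ωh k g) (ball (0 : 𝔜 × Fut W Pot) r)
        (closedBall ((τ₀ : ℂ) • cY k, J k (cY k)) r₄) :=
  holoMaps_step_offCentre hτ₀ hωh hΦd (fun k _ => cY k) hΦoff hJ hroom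

/-- **HISTORY-FREE CENTRES, size**: `‖cY k‖ ≤ cbar₀` for all `k` gives `‖(τ₀ • cY k, J k (cY k))‖ ≤ τ₀·cbar₀` for all `k`
(no window clause needed). [folklore] -/
theorem norm_centre_le_free {cbar₀ : ℝ} (hτ₀ : 0 ≤ τ₀) (hJ : ∀ k, ‖J k‖ ≤ τ₀) (cY : ℕ → 𝔜)
    (hcY : ∀ k, ‖cY k‖ ≤ cbar₀) (k : ℕ) :
    ‖(((τ₀ : ℂ) • cY k, J k (cY k)) : 𝔜 × Fut W Pot)‖ ≤ τ₀ * cbar₀ :=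
  (norm_centre_le hτ₀ hJ k (cY k)).trans (mul_le_mul_of_nonneg_left (hcY k) hτ₀)

/-! ## §5 THE ∃-FORM (idea-1's §7 `offCentreMaps_step`, offer O-v9-T): the docking face of `chainLipschitz_of_offCentreMaps_polydisc` -/

/-- **THE OFF-CENTRE SELF-MAP DATA OF ROUTE R4's STEP, ∃-form** (= `t4/ideate/NE9/lens1-NE9OffCentreChain.lean` §7, planner
`t4-ne9-idea-1` gen 9, lifted with the binder `hr : 0 < r` DROPPED — unused once holomorphy comes from §1; callers of the scratch's
positional form delete that one argument): if `Φ k (g k)` maps the table ball `B(0,r)` into `B̄(Φ₀, B₁)` for SOME `Φ₀` with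
`‖Φ₀‖ ≤ P₀` (the centre may depend on `k` and on `g`), `‖J k‖ ≤ τ₀`, and the room is SPLIT as `ωh·r + τ₀·B₁ ≤ t·r`, `τ₀·P₀ ≤ c̄·r`,
then `step k g` is holomorphic on `B(0,r)` with image in an off-centre ball `B̄(c, t·r)`, `‖c‖ ≤ c̄·r` — literally the hypothesis
`hS` of idea-1's §5 `chainLipschitz_of_offCentreMaps_polydisc` ((T-a) in the ∃-form; with it, `ChainLipschitz (step …) W r θ
(1∕(1−θ²)) λ` at `θ = c̄ + t` for every `λ` passing the refuter's quadratic test).  Compare K2♭'s `mapsTo_step` (`c = 0`, room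
`ωh·r + τ₀·(P₀ + B₁) ≤ θ·r`): the same total room, the table-free part spent on the CENTRE. [folklore] -/
theorem offCentreMaps_step {r P₀ B₁ t cb : ℝ} (hτ₀ : 0 ≤ τ₀) (hωh : 0 ≤ ωh)
    (hΦd : ∀ k, ∀ g ∈ W, DifferentiableOn ℂ (Φ k (g k)) (ball (0 : Pot) r))
    (hΦoff : ∀ k, ∀ g ∈ W, ∃ Φ₀ : 𝔜, ‖Φ₀‖ ≤ P₀ ∧ MapsTo (Φ k (g k)) (ball (0 : Pot) r) (closedBall Φ₀ B₁))
    (hJ : ∀ k, ‖J k‖ ≤ τ₀) (ht : ωh * r + τ₀ * B₁ ≤ t * r) (hcb : τ₀ * P₀ ≤ cb * r) :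
    ∀ k, ∀ g ∈ W, DifferentiableOn ℂ (step W Φ J τ₀ ωh k g) (ball (0 : 𝔜 × Fut W Pot) r) ∧
      ∃ c : 𝔜 × Fut W Pot, ‖c‖ ≤ cb * r ∧
        MapsTo (step W Φ J τ₀ ωh k g) (ball (0 : 𝔜 × Fut W Pot) r) (closedBall c (t * r)) := by
  intro k g hg
  obtain ⟨Φ₀, hΦ₀, hm⟩ := hΦoff k g hg
  exact ⟨differentiableOn_step hΦd k hg, ((τ₀ : ℂ) • Φ₀, J k Φ₀),
    (norm_centre_le hτ₀ hJ k Φ₀).trans ((mul_le_mul_of_nonneg_left hΦ₀ hτ₀).trans hcb),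
    mapsTo_step_offCentre hτ₀ hωh hJ ht k hg hm⟩

omit [NormedSpace ℂ 𝔜] [NormedSpace ℂ Pot] in
/-- The family datum of §4 feeds the ∃-form of §5 (with `P₀ := cbar₀`). [folklore] -/
theorem exists_offCentre_of_family {r B₁ cbar₀ : ℝ} (cY : ℕ → (ℕ → ℝ) → 𝔜)
    (hΦoff : ∀ k, ∀ g ∈ W, MapsTo (Φ k (g k)) (ball (0 : Pot) r) (closedBall (cY k g) B₁))
    (hcY : ∀ k, ∀ g ∈ W, ‖cY k g‖ ≤ cbar₀) :
    ∀ k, ∀ g ∈ W, ∃ Φ₀ : 𝔜, ‖Φ₀‖ ≤ cbar₀ ∧ MapsTo (Φ k (g k)) (ball (0 : Pot) r) (closedBall Φ₀ B₁) :=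
  fun k g hg => ⟨cY k g, hcY k g hg, hΦoff k g hg⟩

/-! ## §6 CONSISTENCY WITH K2♭: the off-centre binders with the total room give the centred `hΦb` and `HoloSelfMaps` BY NAME -/

omit [NormedSpace ℂ 𝔜] [NormedSpace ℂ Pot] in
/-- From the off-centre Φ-size, K2♭'s CENTRED Φ-size `hΦb` with `B₀ := cbar₀ + B₁` (the binder of the ENDs of record
`…_of_holoSlice_injRead_of_chain` ∕ `…_SP`; monotonicity `closedBall (cY k g) B₁ ⊆ closedBall 0 (cbar₀ + B₁)`). [folklore] -/
theorem mapsTo_centred_of_offCentre {r B₁ cbar₀ : ℝ} (cY : ℕ → (ℕ → ℝ) → 𝔜)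
    (hΦoff : ∀ k, ∀ g ∈ W, MapsTo (Φ k (g k)) (ball (0 : Pot) r) (closedBall (cY k g) B₁))
    (hcY : ∀ k, ∀ g ∈ W, ‖cY k g‖ ≤ cbar₀) :
    ∀ k, ∀ g ∈ W, MapsTo (Φ k (g k)) (ball (0 : Pot) r) (closedBall 0 (cbar₀ + B₁)) :=
  fun k g hg => mapsTo_closedBall_zero_of_offCentre (hΦoff k g hg) (hcY k g hg)

/-- **K2♭ BY NAME FROM THE OFF-CENTRE BINDERS.**  With the TOTAL room `τ₀·cbar₀ + r₄ ≤ θ·r` (= K2♭'s `ωh·r + τ₀·(cbar₀ + B₁) ≤ θ·r`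
when `r₄ = ωh·r + τ₀·B₁`) the off-centre data give `HoloSelfMaps (step W Φ J τ₀ ωh) W r θ` — so M2's centred chain at rate θ and
every END of record built on it remain available from the SAME binders; the off-centre chain ((T-a)) only replaces the per-step factor
θ by λ ≤ θ (< θ as soon as `cbar₀ > 0`). [folklore] -/
theorem holoSelfMaps_of_offCentre {r B₁ cbar₀ r₄ θ : ℝ} (hτ₀ : 0 ≤ τ₀) (hωh : 0 ≤ ωh)
    (hΦd : ∀ k, ∀ g ∈ W, DifferentiableOn ℂ (Φ k (g k)) (ball (0 : Pot) r)) (cY : ℕ → (ℕ → ℝ) → 𝔜)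
    (hΦoff : ∀ k, ∀ g ∈ W, MapsTo (Φ k (g k)) (ball (0 : Pot) r) (closedBall (cY k g) B₁))
    (hcY : ∀ k, ∀ g ∈ W, ‖cY k g‖ ≤ cbar₀) (hJ : ∀ k, ‖J k‖ ≤ τ₀) (hroom : ωh * r + τ₀ * B₁ ≤ r₄)
    (hθ : τ₀ * cbar₀ + r₄ ≤ θ * r) :
    HoloSelfMaps (step W Φ J τ₀ ωh) W r θ := by
  intro k g hg
  obtain ⟨hd, hm⟩ := holoMaps_step_offCentre hτ₀ hωh hΦd cY hΦoff hJ hroom k g hg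
  refine ⟨hd, ?_⟩
  exact (mapsTo_closedBall_zero_of_offCentre hm (norm_centre_le_of_le hτ₀ hJ cY hcY k g hg)).mono_right
    (closedBall_subset_closedBall hθ)

/-- §6 at HISTORY-FREE centres (`‖cY k‖ ≤ cbar₀` for all `k`). [folklore] -/
theorem holoSelfMaps_of_offCentre_free {r B₁ cbar₀ r₄ θ : ℝ} (hτ₀ : 0 ≤ τ₀) (hωh : 0 ≤ ωh)
    (hΦd : ∀ k, ∀ g ∈ W, DifferentiableOn ℂ (Φ k (g k)) (ball (0 : Pot) r)) (cY : ℕ → 𝔜)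
    (hΦoff : ∀ k, ∀ g ∈ W, MapsTo (Φ k (g k)) (ball (0 : Pot) r) (closedBall (cY k) B₁))
    (hcY : ∀ k, ‖cY k‖ ≤ cbar₀) (hJ : ∀ k, ‖J k‖ ≤ τ₀) (hroom : ωh * r + τ₀ * B₁ ≤ r₄)
    (hθ : τ₀ * cbar₀ + r₄ ≤ θ * r) :
    HoloSelfMaps (step W Φ J τ₀ ωh) W r θ :=
  holoSelfMaps_of_offCentre hτ₀ hωh hΦd (fun k _ => cY k) hΦoff (fun k _ _ => hcY k) hJ hroom hθ

/-! ## §7 Non-vacuity: a toy with a genuinely HISTORY-FREE centre (every binder of §4 ∕ §6 inhabited, θ = 19∕32 < 1) -/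

/-- TOY: `𝔜 = Pot = ℂ`, window `]0, 1∕8]`, `Φ k s P := 1∕4 + s·P` (table-free part `1∕4`, table part of size `|s|·‖P‖ ≤ 1∕8` on the unit
ball), `J k := 0`, `τ₀ = 1∕4`, `ωh = 1∕2`, `r = 1`: the off-centre Φ-size holds with the HISTORY-FREE centre `cY k = 1∕4`, `B₁ = 1∕8`.
[folklore] -/
theorem toy_hΦoff : ∀ k : ℕ, ∀ g ∈ Window (1 / 8),
    MapsTo ((fun (_ : ℕ) (s : ℝ) (P : ℂ) => (1 / 4 : ℂ) + (s : ℂ) * P) k (g k)) (ball (0 : ℂ) 1)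
      (closedBall ((fun _ : ℕ => (1 / 4 : ℂ)) k) (1 / 8)) := by
  intro k g hg P hP
  rw [mem_ball_zero_iff] at hP
  have hs := mem_window.mp hg k
  rw [mem_closedBall, dist_eq_norm, add_sub_cancel_left, norm_mul, Complex.norm_real, Real.norm_of_nonneg hs.1.le]
  calc g k * ‖P‖ ≤ 1 / 8 * 1 := mul_le_mul hs.2 hP.le (norm_nonneg P) (by norm_num)
    _ = 1 / 8 := by norm_num

/-- TOY, continued: §4's interface FIRES — the step maps the unit ball of 𝔛 into the off-centre ball with centre
`((1∕4 : ℂ) • (1∕4 : ℂ), 0)` (norm `1∕16`) and radius `r₄ = 1∕2·1 + 1∕4·1∕8 = 17∕32`. [folklore] -/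
example : ∀ k : ℕ, ∀ g ∈ Window (1 / 8),
    DifferentiableOn ℂ (step (𝔜 := ℂ) (Pot := ℂ) (Window (1 / 8)) (fun _ s P => (1 / 4 : ℂ) + (s : ℂ) * P) (fun _ => 0)
      (1 / 4) (1 / 2) k g) (ball 0 1) ∧
    MapsTo (step (𝔜 := ℂ) (Pot := ℂ) (Window (1 / 8)) (fun _ s P => (1 / 4 : ℂ) + (s : ℂ) * P) (fun _ => 0) (1 / 4) (1 / 2)
      k g) (ball 0 1) (closedBall ((((1 / 4 : ℝ) : ℂ)) • (1 / 4 : ℂ), (0 : ℂ →L[ℂ] Fut (Window (1 / 8)) ℂ) (1 / 4 : ℂ)) (17 / 32)) :=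
  holoMaps_step_offCentre_free (by norm_num) (by norm_num)
    (fun _ _ _ => ((differentiable_const _).add ((differentiable_const _).mul differentiable_id)).differentiableOn)
    (fun _ => (1 / 4 : ℂ)) toy_hΦoff (fun _ => by rw [norm_zero]; norm_num) (by norm_num)

/-- TOY, concluded: with `cbar₀ = 1∕4` the centre has norm `≤ 1∕16` and the TOTAL room `1∕16 + 17∕32 = 19∕32 ≤ θ` returns K2♭'s
`HoloSelfMaps … 1 (19∕32)` BY NAME (§6) — the same θ as K2♭'s §10 toy, now with the table-free part booked as a centre. [folklore] -/
example : HoloSelfMaps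
    (step (𝔜 := ℂ) (Pot := ℂ) (Window (1 / 8)) (fun _ s P => (1 / 4 : ℂ) + (s : ℂ) * P) (fun _ => 0) (1 / 4) (1 / 2))
    (Window (1 / 8)) 1 (19 / 32) :=
  holoSelfMaps_of_offCentre_free (B₁ := 1 / 8) (cbar₀ := 1 / 4) (r₄ := 17 / 32) (by norm_num) (by norm_num)
    (fun _ _ _ => ((differentiable_const _).add ((differentiable_const _).mul differentiable_id)).differentiableOn)
    (fun _ => (1 / 4 : ℂ)) toy_hΦoff (fun _ => by norm_num) (fun _ => by rw [norm_zero]; norm_num) (by norm_num) (by norm_num)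

end Summit.QuantumFields.BalabanUV.T4Continuum.NE9FutureProfileStepOffCentre
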